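import Summits.AtomisticToContinuum.Crystallization.Theorems.ExcessDecayLiouvilleHcpLiouvilleBlowdownGreenCrossB2

/-!
# `ExcessDecayLiouville.HcpLiouville` (stmt-AtomisticToContinuum-9332), line `Sketch` v4: the Green's operator by the dipole decomposition

Part H3e of stub `stub_green`, lead file.  (1) The response to a dipole `(δ_p − δ_q) η` between ANY two sites is
square-summable with `‖G_p η − G_q η‖_{ℓ²} ≤ C_pair (1 + dist p q) ‖η‖` (`Blowdown.pair_sq_le`): same-sublattice pairs
by a lattice translation (`translateTerm_sq_le`), cross pairs through the reference cross pair `(t 0, t 1)`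
(`cross_bound`, taken as the hypothesis `hcross`) and one more translation.  (2) THE DIPOLE DECOMPOSITION: for an
antisymmetric bond field `M` with `W = Σ_{p,q} ‖M p q‖ (1 + dist p q) < ∞`, the divergence `f p = Σ_q M p q` is the
pointwise sum over ordered pairs of the dipoles `(δ_p − δ_q)(½ M p q)` (`Blowdown.hasSum_dipoles_div`), all admissible
with summable bounds; by countable additivity `z = 𝒢 f` is the pointwise sum of the dipole responses, so the countable
Minkowski inequality gives `Σ_x ‖z x‖² ≤ (C_pair W / 2)²`, while clause (i) gives the rows
(`Blowdown.green_dipole_decomposition`).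
All `[folklore]`; a `--supports` helper for item stmt-AtomisticToContinuum-9332, nothing here closes an item.
-/

noncomputable section

namespace Summit.AtomisticToContinuum.Crystallization.Theorems.ExcessDecayLiouville

open scoped BigOperators Topology Classical InnerProductSpace RealInnerProductSpace
open Literature.MathematicalPhysics.StatisticalMechanics
open Summit.AtomisticToContinuum.Crystallization.Theses.ExcessDecayLiouville
open Summit.AtomisticToContinuum.Crystallization.Theorems.PhononStabilityNegative

namespace Blowdown

section

variable {t : Fin 2 → EuclideanSpace ℝ (Fin 3)} {A : EuclideanSpace ℝ (Fin 3) →L[ℝ] EuclideanSpace ℝ (Fin 3)}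
  {𝒢 : (EuclideanSpace ℝ (Fin 3) → EuclideanSpace ℝ (Fin 3)) → EuclideanSpace ℝ (Fin 3) → EuclideanSpace ℝ (Fin 3)}

/-! ## Same-sublattice pairs -/

/-- **Same-sublattice dipole response in `ℓ²`**: for `c, q` on one sublattice, `q = c + A e` (`e ∈ Λ₀`),
`Σ'_x ‖G_c η x − G_q η x‖² ≤ ((1000/189) dist(c,q) (C₂/κ) √C₁ ‖η‖)²`. [folklore] -/
theorem samePair_sq_le (hA : Adm₀ A) {κ C₁ C₂ : ℝ} (hκ : 0 < κ) (hC₂ : 0 ≤ C₂)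
    (hcap : ∀ w : EuclideanSpace ℝ (Fin 3) → EuclideanSpace ℝ (Fin 3), (Function.support w).Finite →
      Function.support w ⊆ Sites₀ t A → ∀ p ∈ Sites₀ t A, ‖w p‖ ^ 2 ≤ C₁ * nnForm t A w)
    (hiv : ∀ (f : EuclideanSpace ℝ (Fin 3) → EuclideanSpace ℝ (Fin 3)) (N : ℝ), 0 ≤ N →
      (∀ w : EuclideanSpace ℝ (Fin 3) → EuclideanSpace ℝ (Fin 3), (Function.support w).Finite → Function.support w ⊆ Sites₀ t A → |∑' p : Sites₀ t A, ⟪f p, w p⟫| ≤ N * Real.sqrt (nnForm t A w)) →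
      ∀ e ∈ ({triangularVec₁ 1, triangularVec₂ 1, layerNormal (2 * Real.sqrt (2 / 3))} : Finset (EuclideanSpace ℝ (Fin 3))),
        Summable (fun p : Sites₀ t A => ‖𝒢 f (p + A e) - 𝒢 f p‖ ^ 2) ∧
        ∑' p : Sites₀ t A, ‖𝒢 f (p + A e) - 𝒢 f p‖ ^ 2 ≤ (C₂ / κ * N) ^ 2)
    (hvi : ∀ (f : EuclideanSpace ℝ (Fin 3) → EuclideanSpace ℝ (Fin 3)) (N : ℝ), 0 ≤ N →
      (∀ w : EuclideanSpace ℝ (Fin 3) → EuclideanSpace ℝ (Fin 3), (Function.support w).Finite → Function.support w ⊆ Sites₀ t A → |∑' p : Sites₀ t A, ⟪f p, w p⟫| ≤ N * Real.sqrt (nnForm t A w)) →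
      ∀ e ∈ Λ₀, (∀ w : EuclideanSpace ℝ (Fin 3) → EuclideanSpace ℝ (Fin 3), (Function.support w).Finite → Function.support w ⊆ Sites₀ t A → |∑' p : Sites₀ t A, ⟪(fun x => f (x - A e)) p, w p⟫| ≤ N * Real.sqrt (nnForm t A w)) →
      ∀ p ∈ Sites₀ t A, 𝒢 (fun x => f (x - A e)) p = 𝒢 f (p - A e))
    {c : EuclideanSpace ℝ (Fin 3)} (hc : c ∈ Sites₀ t A) {e : EuclideanSpace ℝ (Fin 3)} (he : e ∈ Λ₀) (η : EuclideanSpace ℝ (Fin 3)) :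
    Summable (fun x : Sites₀ t A => ‖𝒢 (fun y : EuclideanSpace ℝ (Fin 3) => if y = c then η else 0) x - 𝒢 (fun y : EuclideanSpace ℝ (Fin 3) => if y = (c + A e) then η else 0) x‖ ^ 2) ∧
      ∑' x : Sites₀ t A, ‖𝒢 (fun y : EuclideanSpace ℝ (Fin 3) => if y = c then η else 0) x - 𝒢 (fun y : EuclideanSpace ℝ (Fin 3) => if y = (c + A e) then η else 0) x‖ ^ 2 ≤
        ((1000 / 189 : ℝ) * dist c (c + A e) * (C₂ / κ * (Real.sqrt C₁ * ‖η‖))) ^ 2 := by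
  have htr : ∀ x : Sites₀ t A, 𝒢 (fun y : EuclideanSpace ℝ (Fin 3) => if y = (c + A e) then η else 0) x = 𝒢 (fun y : EuclideanSpace ℝ (Fin 3) => if y = c then η else 0) (x - (c + A e) + c) := by
    intro x
    rw [green_single_translate (t := t) (A := A) 𝒢 hcap hvi hc he η x.2]
    congr 1; abel
  simp only [htr]
  exact translateTerm_sq_le (𝒢 := 𝒢) hA hκ hC₂ hcap hiv hc he η

/-! ## Arbitrary pairs -/

/-- **Dipole response in `ℓ²` for an arbitrary pair of sites** (see the module docstring); `hcross` is the bound of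
`cross_bound` for the reference cross pair with constant `Ccr`. [folklore] -/
theorem pair_sq_le (hA : Adm₀ A) (hI : Inner₀ t A) {κ C₁ C₂ Ccr : ℝ} (hκ : 0 < κ) (hC₂ : 0 ≤ C₂) (hCcr : 0 ≤ Ccr)
    (hcap : ∀ w : EuclideanSpace ℝ (Fin 3) → EuclideanSpace ℝ (Fin 3), (Function.support w).Finite →
      Function.support w ⊆ Sites₀ t A → ∀ p ∈ Sites₀ t A, ‖w p‖ ^ 2 ≤ C₁ * nnForm t A w)
    (hiv : ∀ (f : EuclideanSpace ℝ (Fin 3) → EuclideanSpace ℝ (Fin 3)) (N : ℝ), 0 ≤ N →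
      (∀ w : EuclideanSpace ℝ (Fin 3) → EuclideanSpace ℝ (Fin 3), (Function.support w).Finite → Function.support w ⊆ Sites₀ t A → |∑' p : Sites₀ t A, ⟪f p, w p⟫| ≤ N * Real.sqrt (nnForm t A w)) →
      ∀ e ∈ ({triangularVec₁ 1, triangularVec₂ 1, layerNormal (2 * Real.sqrt (2 / 3))} : Finset (EuclideanSpace ℝ (Fin 3))),
        Summable (fun p : Sites₀ t A => ‖𝒢 f (p + A e) - 𝒢 f p‖ ^ 2) ∧
        ∑' p : Sites₀ t A, ‖𝒢 f (p + A e) - 𝒢 f p‖ ^ 2 ≤ (C₂ / κ * N) ^ 2)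
    (hvi : ∀ (f : EuclideanSpace ℝ (Fin 3) → EuclideanSpace ℝ (Fin 3)) (N : ℝ), 0 ≤ N →
      (∀ w : EuclideanSpace ℝ (Fin 3) → EuclideanSpace ℝ (Fin 3), (Function.support w).Finite → Function.support w ⊆ Sites₀ t A → |∑' p : Sites₀ t A, ⟪f p, w p⟫| ≤ N * Real.sqrt (nnForm t A w)) →
      ∀ e ∈ Λ₀, (∀ w : EuclideanSpace ℝ (Fin 3) → EuclideanSpace ℝ (Fin 3), (Function.support w).Finite → Function.support w ⊆ Sites₀ t A → |∑' p : Sites₀ t A, ⟪(fun x => f (x - A e)) p, w p⟫| ≤ N * Real.sqrt (nnForm t A w)) →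
      ∀ p ∈ Sites₀ t A, 𝒢 (fun x => f (x - A e)) p = 𝒢 f (p - A e))
    (hcross : ∀ η : EuclideanSpace ℝ (Fin 3),
      Summable (fun x : Sites₀ t A => ‖𝒢 (fun y : EuclideanSpace ℝ (Fin 3) => if y = t 0 then η else 0) x - 𝒢 (fun y : EuclideanSpace ℝ (Fin 3) => if y = t 1 then η else 0) x‖ ^ 2) ∧
        ∑' x : Sites₀ t A, ‖𝒢 (fun y : EuclideanSpace ℝ (Fin 3) => if y = t 0 then η else 0) x - 𝒢 (fun y : EuclideanSpace ℝ (Fin 3) => if y = t 1 then η else 0) x‖ ^ 2 ≤ (Ccr * ‖η‖) ^ 2)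
    {p q : EuclideanSpace ℝ (Fin 3)} (hp : p ∈ Sites₀ t A) (hq : q ∈ Sites₀ t A) (η : EuclideanSpace ℝ (Fin 3)) :
    Summable (fun x : Sites₀ t A => ‖𝒢 (fun y : EuclideanSpace ℝ (Fin 3) => if y = p then η else 0) x - 𝒢 (fun y : EuclideanSpace ℝ (Fin 3) => if y = q then η else 0) x‖ ^ 2) ∧
      ∑' x : Sites₀ t A, ‖𝒢 (fun y : EuclideanSpace ℝ (Fin 3) => if y = p then η else 0) x - 𝒢 (fun y : EuclideanSpace ℝ (Fin 3) => if y = q then η else 0) x‖ ^ 2 ≤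
        ((((1100 / 189 : ℝ) * (C₂ / κ * Real.sqrt C₁)) + Ccr) * (1 + dist p q) * ‖η‖) ^ 2 := by
  set L' : ℝ := (1000 / 189 : ℝ) * (C₂ / κ * Real.sqrt C₁) with hL'
  have hL'0 : 0 ≤ L' := by positivity
  have hbig : ∀ d : ℝ, 0 ≤ d → L' * (d + 11 / 10) * ‖η‖ + Ccr * ‖η‖ ≤
      (((1100 / 189 : ℝ) * (C₂ / κ * Real.sqrt C₁)) + Ccr) * (1 + d) * ‖η‖ := by
    intro d hd
    rw [hL']
    have hX : 0 ≤ C₂ / κ * Real.sqrt C₁ := by positivity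
    nlinarith [norm_nonneg η, mul_nonneg hX (norm_nonneg η), mul_nonneg (mul_nonneg hX (norm_nonneg η)) hd,
      mul_nonneg hCcr (mul_nonneg hd (norm_nonneg η))]
  -- same-sublattice case, in the form needed twice
  have hsame : ∀ (c : EuclideanSpace ℝ (Fin 3)) (m : Fin 2) (zc zq : EuclideanSpace ℝ (Fin 3)), zc ∈ Λ₀ → zq ∈ Λ₀ →
      c = t m + A zc → ∀ q' : EuclideanSpace ℝ (Fin 3), q' = t m + A zq →
      Summable (fun x : Sites₀ t A => ‖𝒢 (fun y : EuclideanSpace ℝ (Fin 3) => if y = c then η else 0) x -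
          𝒢 (fun y : EuclideanSpace ℝ (Fin 3) => if y = q' then η else 0) x‖ ^ 2) ∧
        ∑' x : Sites₀ t A, ‖𝒢 (fun y : EuclideanSpace ℝ (Fin 3) => if y = c then η else 0) x -
          𝒢 (fun y : EuclideanSpace ℝ (Fin 3) => if y = q' then η else 0) x‖ ^ 2 ≤ (L' * dist c q' * ‖η‖) ^ 2 := by
    intro c m zc zq hzc hzq hcz q' hq'
    have hc : c ∈ Sites₀ t A := ⟨m, zc, hzc, hcz⟩
    have he : zq - zc ∈ Λ₀ := sub_mem_Λ₀' hzq hzc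
    have hq'e : q' = c + A (zq - zc) := by rw [hq', hcz, map_sub]; abel
    have h := samePair_sq_le (𝒢 := 𝒢) hA hκ hC₂ hcap hiv hvi hc he η
    rw [← hq'e] at h
    refine ⟨h.1, h.2.trans (le_of_eq ?_)⟩
    rw [hL']; ring
  rcases sublattice_cases hA hI ⟨p, hp⟩ with ⟨⟨zp, hzp, hpz⟩, -⟩ | ⟨hp0, ⟨zp, hzp, hpz⟩⟩ <;>
    rcases sublattice_cases hA hI ⟨q, hq⟩ with ⟨⟨zq, hzq, hqz⟩, -⟩ | ⟨hq0, ⟨zq, hzq, hqz⟩⟩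
  · -- both on sublattice 0
    have h := hsame p 0 zp zq hzp hzq hpz q hqz
    refine ⟨h.1, h.2.trans (pow_le_pow_left₀ (by positivity) ?_ 2)⟩
    have := hbig (dist p q) dist_nonneg
    nlinarith [mul_nonneg hL'0 (norm_nonneg η), mul_nonneg hCcr (norm_nonneg η), dist_nonneg (x := p) (y := q)]
  · -- `p ∈ S₀`, `q ∈ S₁`: through `q' = q − t 1 + t 0 ∈ S₀` and the reference cross pair moved by `A zq`
    set q' : EuclideanSpace ℝ (Fin 3) := t 0 + A zq with hq'
    have h1 := hsame p 0 zp zq hzp hzq hpz q' rfl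
    have ha : t 0 ∈ Sites₀ t A := ⟨0, 0, zero_mem_Λ₀, by simp⟩
    have hb : t 1 ∈ Sites₀ t A := ⟨1, 0, zero_mem_Λ₀, by simp⟩
    have h2f : ∀ x : Sites₀ t A, 𝒢 (fun y : EuclideanSpace ℝ (Fin 3) => if y = q' then η else 0) x -
        𝒢 (fun y : EuclideanSpace ℝ (Fin 3) => if y = q then η else 0) x =
        (fun y : EuclideanSpace ℝ (Fin 3) => 𝒢 (fun y : EuclideanSpace ℝ (Fin 3) => if y = t 0 then η else 0) y - 𝒢 (fun y : EuclideanSpace ℝ (Fin 3) => if y = t 1 then η else 0) y) (x - A zq) := by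
      intro x
      have hqz' : q = t 1 + A zq := hqz
      rw [hq', hqz', green_single_translate (t := t) (A := A) 𝒢 hcap hvi ha hzq η x.2,
        green_single_translate (t := t) (A := A) 𝒢 hcap hvi hb hzq η x.2]
    have h2 : Summable (fun x : Sites₀ t A => ‖𝒢 (fun y : EuclideanSpace ℝ (Fin 3) => if y = q' then η else 0) x -
        𝒢 (fun y : EuclideanSpace ℝ (Fin 3) => if y = q then η else 0) x‖ ^ 2) ∧
        ∑' x : Sites₀ t A, ‖𝒢 (fun y : EuclideanSpace ℝ (Fin 3) => if y = q' then η else 0) x -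
          𝒢 (fun y : EuclideanSpace ℝ (Fin 3) => if y = q then η else 0) x‖ ^ 2 ≤ (Ccr * ‖η‖) ^ 2 := by
      simp only [h2f]
      have hs := (summable_shift_iff' (t := t) (A := A)
        (fun y => ‖𝒢 (fun y : EuclideanSpace ℝ (Fin 3) => if y = t 0 then η else 0) y - 𝒢 (fun y : EuclideanSpace ℝ (Fin 3) => if y = t 1 then η else 0) y‖ ^ 2) hzq).2 (hcross η).1
      have ht := tsum_shift_eq' (t := t) (A := A)
        (fun y => ‖𝒢 (fun y : EuclideanSpace ℝ (Fin 3) => if y = t 0 then η else 0) y - 𝒢 (fun y : EuclideanSpace ℝ (Fin 3) => if y = t 1 then η else 0) y‖ ^ 2) hzq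
      exact ⟨hs, ht.trans_le (hcross η).2⟩
    have hsum := sq_summable_add (by positivity) (by positivity) h1 h2
    have hfun : ∀ x : Sites₀ t A, 𝒢 (fun y : EuclideanSpace ℝ (Fin 3) => if y = p then η else 0) x - 𝒢 (fun y : EuclideanSpace ℝ (Fin 3) => if y = q then η else 0) x =
        (𝒢 (fun y : EuclideanSpace ℝ (Fin 3) => if y = p then η else 0) x - 𝒢 (fun y : EuclideanSpace ℝ (Fin 3) => if y = q' then η else 0) x) +
        (𝒢 (fun y : EuclideanSpace ℝ (Fin 3) => if y = q' then η else 0) x - 𝒢 (fun y : EuclideanSpace ℝ (Fin 3) => if y = q then η else 0) x) := by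
      intro x; abel
    simp only [hfun]
    refine ⟨hsum.1, hsum.2.trans (pow_le_pow_left₀ (by positivity) ?_ 2)⟩
    have hdq : dist p q' ≤ dist p q + 11 / 10 := by
      calc dist p q' ≤ dist p q + dist q q' := dist_triangle _ _ _
        _ ≤ dist p q + 11 / 10 := by
            refine add_le_add le_rfl ?_
            have hqz' : q = t 1 + A zq := hqz
            rw [hq', hqz', dist_eq_norm, show t 1 + A zq - (t 0 + A zq) = t 1 - t 0 by abel]
            exact norm_t_sub_t_le hA hI
    calc L' * dist p q' * ‖η‖ + Ccr * ‖η‖ ≤ L' * (dist p q + 11 / 10) * ‖η‖ + Ccr * ‖η‖ := by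
          gcongr
      _ ≤ _ := hbig (dist p q) dist_nonneg
  · -- `p ∈ S₁`, `q ∈ S₀`: swap the roles
    set p' : EuclideanSpace ℝ (Fin 3) := t 0 + A zp with hp'
    have h1 := hsame q 0 zq zp hzq hzp hqz p' rfl
    have ha : t 0 ∈ Sites₀ t A := ⟨0, 0, zero_mem_Λ₀, by simp⟩
    have hb : t 1 ∈ Sites₀ t A := ⟨1, 0, zero_mem_Λ₀, by simp⟩
    have h2f : ∀ x : Sites₀ t A, 𝒢 (fun y : EuclideanSpace ℝ (Fin 3) => if y = p' then η else 0) x -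
        𝒢 (fun y : EuclideanSpace ℝ (Fin 3) => if y = p then η else 0) x =
        (fun y : EuclideanSpace ℝ (Fin 3) => 𝒢 (fun y : EuclideanSpace ℝ (Fin 3) => if y = t 0 then η else 0) y - 𝒢 (fun y : EuclideanSpace ℝ (Fin 3) => if y = t 1 then η else 0) y) (x - A zp) := by
      intro x
      have hpz' : p = t 1 + A zp := hpz
      rw [hp', hpz', green_single_translate (t := t) (A := A) 𝒢 hcap hvi ha hzp η x.2,
        green_single_translate (t := t) (A := A) 𝒢 hcap hvi hb hzp η x.2]
    have h2 : Summable (fun x : Sites₀ t A => ‖𝒢 (fun y : EuclideanSpace ℝ (Fin 3) => if y = p' then η else 0) x -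
        𝒢 (fun y : EuclideanSpace ℝ (Fin 3) => if y = p then η else 0) x‖ ^ 2) ∧
        ∑' x : Sites₀ t A, ‖𝒢 (fun y : EuclideanSpace ℝ (Fin 3) => if y = p' then η else 0) x -
          𝒢 (fun y : EuclideanSpace ℝ (Fin 3) => if y = p then η else 0) x‖ ^ 2 ≤ (Ccr * ‖η‖) ^ 2 := by
      simp only [h2f]
      have hs := (summable_shift_iff' (t := t) (A := A)
        (fun y => ‖𝒢 (fun y : EuclideanSpace ℝ (Fin 3) => if y = t 0 then η else 0) y - 𝒢 (fun y : EuclideanSpace ℝ (Fin 3) => if y = t 1 then η else 0) y‖ ^ 2) hzp).2 (hcross η).1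
      have ht := tsum_shift_eq' (t := t) (A := A)
        (fun y => ‖𝒢 (fun y : EuclideanSpace ℝ (Fin 3) => if y = t 0 then η else 0) y - 𝒢 (fun y : EuclideanSpace ℝ (Fin 3) => if y = t 1 then η else 0) y‖ ^ 2) hzp
      exact ⟨hs, ht.trans_le (hcross η).2⟩
    have hsum := sq_summable_add (by positivity) (by positivity) h1 h2
    have hfun : ∀ x : Sites₀ t A, ‖𝒢 (fun y : EuclideanSpace ℝ (Fin 3) => if y = p then η else 0) x - 𝒢 (fun y : EuclideanSpace ℝ (Fin 3) => if y = q then η else 0) x‖ ^ 2 =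
        ‖(𝒢 (fun y : EuclideanSpace ℝ (Fin 3) => if y = q then η else 0) x - 𝒢 (fun y : EuclideanSpace ℝ (Fin 3) => if y = p' then η else 0) x) +
        (𝒢 (fun y : EuclideanSpace ℝ (Fin 3) => if y = p' then η else 0) x - 𝒢 (fun y : EuclideanSpace ℝ (Fin 3) => if y = p then η else 0) x)‖ ^ 2 := by
      intro x; rw [← norm_neg]; congr 2; abel
    simp only [hfun]
    refine ⟨hsum.1, hsum.2.trans (pow_le_pow_left₀ (by positivity) ?_ 2)⟩
    have hdq : dist q p' ≤ dist p q + 11 / 10 := by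
      calc dist q p' ≤ dist q p + dist p p' := dist_triangle _ _ _
        _ ≤ dist p q + 11 / 10 := by
            rw [dist_comm q p]
            refine add_le_add le_rfl ?_
            have hpz' : p = t 1 + A zp := hpz
            rw [hp', hpz', dist_eq_norm, show t 1 + A zp - (t 0 + A zp) = t 1 - t 0 by abel]
            exact norm_t_sub_t_le hA hI
    calc L' * dist q p' * ‖η‖ + Ccr * ‖η‖ ≤ L' * (dist p q + 11 / 10) * ‖η‖ + Ccr * ‖η‖ := by
          gcongr
      _ ≤ _ := hbig (dist p q) dist_nonneg
  · -- both on sublattice 1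
    have h := hsame p 1 zp zq hzp hzq hpz q hqz
    refine ⟨h.1, h.2.trans (pow_le_pow_left₀ (by positivity) ?_ 2)⟩
    have := hbig (dist p q) dist_nonneg
    nlinarith [mul_nonneg hL'0 (norm_nonneg η), mul_nonneg hCcr (norm_nonneg η), dist_nonneg (x := p) (y := q)]

/-! ## The divergence of an antisymmetric bond field as a sum of dipoles -/

/-- **The divergence is the pointwise sum of the dipoles** `(δ_p − δ_q)(½ M p q)` over ordered pairs. [folklore] -/
theorem hasSum_dipoles_div (M : EuclideanSpace ℝ (Fin 3) → EuclideanSpace ℝ (Fin 3) → EuclideanSpace ℝ (Fin 3))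
    (hM : ∀ p q : EuclideanSpace ℝ (Fin 3), M q p = -M p q)
    (hW : Summable (fun pq : Sites₀ t A × Sites₀ t A =>
      ‖M pq.1 pq.2‖ * (1 + dist (pq.1 : EuclideanSpace ℝ (Fin 3)) pq.2)))
    {x : EuclideanSpace ℝ (Fin 3)} (hx : x ∈ Sites₀ t A) :
    HasSum (fun pq : Sites₀ t A × Sites₀ t A => (fun y : EuclideanSpace ℝ (Fin 3) =>
        (if y = pq.1 then (1 / 2 : ℝ) • M pq.1 pq.2 else 0) - (if y = pq.2 then (1 / 2 : ℝ) • M pq.1 pq.2 else 0)) x)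
      (∑' q : Sites₀ t A, M x q) := by
  set x₀ : Sites₀ t A := ⟨x, hx⟩ with hx₀
  -- summability of `‖M‖` on pairs and of its fibres
  have hMs : Summable (fun pq : Sites₀ t A × Sites₀ t A => ‖M pq.1 pq.2‖) := by
    refine Summable.of_nonneg_of_le (fun _ => norm_nonneg _) (fun pq => ?_) hW
    have : 0 ≤ dist (pq.1 : EuclideanSpace ℝ (Fin 3)) pq.2 := dist_nonneg
    nlinarith [norm_nonneg (M pq.1 pq.2)]
  have hMs' : Summable (fun pq : Sites₀ t A × Sites₀ t A => M pq.1 pq.2) := hMs.of_norm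
  have hrow : Summable (fun q : Sites₀ t A => M x q) := by
    simpa [hx₀] using hMs'.prod_factor x₀
  have hcol : Summable (fun p : Sites₀ t A => M p x) := by
    have h := hrow.neg
    refine h.congr fun p => ?_
    rw [hM, neg_neg]
  -- the two halves
  set P₁ : Sites₀ t A × Sites₀ t A → EuclideanSpace ℝ (Fin 3) := fun pq =>
      if x = (pq.1 : EuclideanSpace ℝ (Fin 3)) then (1 / 2 : ℝ) • M pq.1 pq.2 else 0 with hP₁
  set P₂ : Sites₀ t A × Sites₀ t A → EuclideanSpace ℝ (Fin 3) := fun pq =>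
      if x = (pq.2 : EuclideanSpace ℝ (Fin 3)) then (1 / 2 : ℝ) • M pq.1 pq.2 else 0 with hP₂
  have hP₁s : Summable P₁ := by
    refine Summable.of_norm_bounded (hMs.mul_left (1 / 2)) fun pq => ?_
    simp only [hP₁]
    split_ifs
    · rw [norm_smul, Real.norm_eq_abs, abs_of_pos (by norm_num : (0 : ℝ) < 1 / 2)]
    · rw [norm_zero]; positivity
  have hP₂s : Summable P₂ := by
    refine Summable.of_norm_bounded (hMs.mul_left (1 / 2)) fun pq => ?_
    simp only [hP₂]
    split_ifs
    · rw [norm_smul, Real.norm_eq_abs, abs_of_pos (by norm_num : (0 : ℝ) < 1 / 2)]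
    · rw [norm_zero]; positivity
  have hmem : ∀ p : Sites₀ t A, (x = (p : EuclideanSpace ℝ (Fin 3))) ↔ p = x₀ := fun p =>
    ⟨fun h => Subtype.ext h.symm, fun h => by rw [h]⟩
  have hP₁t : ∑' pq, P₁ pq = (1 / 2 : ℝ) • ∑' q : Sites₀ t A, M x q := by
    rw [hP₁s.tsum_prod' (fun p => ?_)]
    · have hin : ∀ p : Sites₀ t A, ∑' q : Sites₀ t A, P₁ (p, q) = if p = x₀ then (1 / 2 : ℝ) • ∑' q : Sites₀ t A, M x q else 0 := by
        intro p
        by_cases hp : p = x₀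
        · rw [if_pos hp]
          have : (fun q : Sites₀ t A => P₁ (p, q)) = fun q : Sites₀ t A => (1 / 2 : ℝ) • M x q := by
            funext q; simp [hP₁, hp, hx₀]
          rw [this, hrow.tsum_const_smul]
        · rw [if_neg hp]
          have : (fun q : Sites₀ t A => P₁ (p, q)) = fun _ => 0 := by
            funext q; simp only [hP₁, if_neg (fun h => hp ((hmem p).1 h))]
          rw [this, tsum_zero]
      rw [tsum_congr hin, tsum_ite_eq]
    · by_cases hp : p = x₀
      · have : (fun q : Sites₀ t A => P₁ (p, q)) = fun q : Sites₀ t A => (1 / 2 : ℝ) • M x q := by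
          funext q; simp [hP₁, hp, hx₀]
        rw [this]; exact hrow.const_smul _
      · have : (fun q : Sites₀ t A => P₁ (p, q)) = fun _ => 0 := by
          funext q; simp only [hP₁, if_neg (fun h => hp ((hmem p).1 h))]
        rw [this]; exact summable_zero
  have hP₂t : ∑' pq, P₂ pq = -((1 / 2 : ℝ) • ∑' q : Sites₀ t A, M x q) := by
    rw [hP₂s.tsum_prod' (fun p => ?_)]
    · have hin : ∀ p : Sites₀ t A, ∑' q : Sites₀ t A, P₂ (p, q) = (1 / 2 : ℝ) • M p x := by
        intro p
        rw [tsum_eq_single x₀]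
        · simp only [hP₂, hx₀, if_true]
        · intro q hq
          simp only [hP₂, if_neg (fun h => hq ((hmem q).1 h))]
      rw [tsum_congr hin, hcol.tsum_const_smul, ← smul_neg, ← tsum_neg]
      congr 1
      exact tsum_congr fun p => by rw [hM]
    · refine summable_of_ne_finset_zero (s := {x₀}) fun q hq => ?_
      rw [Finset.mem_singleton] at hq
      simp only [hP₂, if_neg (fun h => hq ((hmem q).1 h))]
  have h := hP₁s.hasSum.sub hP₂s.hasSum
  rw [hP₁t, hP₂t, sub_neg_eq_add, ← add_smul, show (1 / 2 : ℝ) + 1 / 2 = 1 by norm_num, one_smul] at h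
  exact h

/-! ## The dipole decomposition of the Green's operator -/

/-- **`L⁻¹ div : ℓ^{1,1} → ℓ²` by the dipole decomposition** (see the module docstring). [folklore] -/
theorem green_dipole_decomposition (hA : Adm₀ A) (hI : Inner₀ t A) {κ C₀ C₁ C₂ Ccr : ℝ} (hκ : 0 < κ) (hC₀ : 0 ≤ C₀)
    (hC₂ : 0 ≤ C₂) (hCcr : 0 ≤ Ccr)
    (hpath : ∀ w : EuclideanSpace ℝ (Fin 3) → EuclideanSpace ℝ (Fin 3), (Function.support w).Finite →
      Function.support w ⊆ Sites₀ t A → ∀ p ∈ Sites₀ t A, ∀ q ∈ Sites₀ t A,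
        ‖w p - w q‖ ≤ C₀ * (1 + dist p q) * Real.sqrt (nnForm t A w))
    (hcap : ∀ w : EuclideanSpace ℝ (Fin 3) → EuclideanSpace ℝ (Fin 3), (Function.support w).Finite →
      Function.support w ⊆ Sites₀ t A → ∀ p ∈ Sites₀ t A, ‖w p‖ ^ 2 ≤ C₁ * nnForm t A w)
    (hi : ∀ (f : EuclideanSpace ℝ (Fin 3) → EuclideanSpace ℝ (Fin 3)) (N : ℝ), 0 ≤ N →
      (∀ w : EuclideanSpace ℝ (Fin 3) → EuclideanSpace ℝ (Fin 3), (Function.support w).Finite → Function.support w ⊆ Sites₀ t A → |∑' p : Sites₀ t A, ⟪f p, w p⟫| ≤ N * Real.sqrt (nnForm t A w)) →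
      ∀ p : Sites₀ t A, HasSum (fun q : Sites₀ t A => forceConst ((p : EuclideanSpace ℝ (Fin 3)) - q) (𝒢 f p - 𝒢 f q)) (f p))
    (hiv : ∀ (f : EuclideanSpace ℝ (Fin 3) → EuclideanSpace ℝ (Fin 3)) (N : ℝ), 0 ≤ N →
      (∀ w : EuclideanSpace ℝ (Fin 3) → EuclideanSpace ℝ (Fin 3), (Function.support w).Finite → Function.support w ⊆ Sites₀ t A → |∑' p : Sites₀ t A, ⟪f p, w p⟫| ≤ N * Real.sqrt (nnForm t A w)) →
      ∀ e ∈ ({triangularVec₁ 1, triangularVec₂ 1, layerNormal (2 * Real.sqrt (2 / 3))} : Finset (EuclideanSpace ℝ (Fin 3))),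
        Summable (fun p : Sites₀ t A => ‖𝒢 f (p + A e) - 𝒢 f p‖ ^ 2) ∧
        ∑' p : Sites₀ t A, ‖𝒢 f (p + A e) - 𝒢 f p‖ ^ 2 ≤ (C₂ / κ * N) ^ 2)
    (hv : ∀ (f : EuclideanSpace ℝ (Fin 3) → EuclideanSpace ℝ (Fin 3)) (N : ℝ), 0 ≤ N →
      (∀ w : EuclideanSpace ℝ (Fin 3) → EuclideanSpace ℝ (Fin 3), (Function.support w).Finite → Function.support w ⊆ Sites₀ t A → |∑' p : Sites₀ t A, ⟪f p, w p⟫| ≤ N * Real.sqrt (nnForm t A w)) →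
      ∀ c : ℝ, ∀ p ∈ Sites₀ t A, 𝒢 (c • f) p = c • 𝒢 f p)
    (hvi : ∀ (f : EuclideanSpace ℝ (Fin 3) → EuclideanSpace ℝ (Fin 3)) (N : ℝ), 0 ≤ N →
      (∀ w : EuclideanSpace ℝ (Fin 3) → EuclideanSpace ℝ (Fin 3), (Function.support w).Finite → Function.support w ⊆ Sites₀ t A → |∑' p : Sites₀ t A, ⟪f p, w p⟫| ≤ N * Real.sqrt (nnForm t A w)) →
      ∀ e ∈ Λ₀, (∀ w : EuclideanSpace ℝ (Fin 3) → EuclideanSpace ℝ (Fin 3), (Function.support w).Finite → Function.support w ⊆ Sites₀ t A → |∑' p : Sites₀ t A, ⟪(fun x => f (x - A e)) p, w p⟫| ≤ N * Real.sqrt (nnForm t A w)) →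
      ∀ p ∈ Sites₀ t A, 𝒢 (fun x => f (x - A e)) p = 𝒢 f (p - A e))
    (hvii : ∀ (f g : EuclideanSpace ℝ (Fin 3) → EuclideanSpace ℝ (Fin 3)) (Nf Ng : ℝ), 0 ≤ Nf → 0 ≤ Ng →
      (∀ w : EuclideanSpace ℝ (Fin 3) → EuclideanSpace ℝ (Fin 3), (Function.support w).Finite → Function.support w ⊆ Sites₀ t A → |∑' p : Sites₀ t A, ⟪f p, w p⟫| ≤ Nf * Real.sqrt (nnForm t A w)) →
      (∀ w : EuclideanSpace ℝ (Fin 3) → EuclideanSpace ℝ (Fin 3), (Function.support w).Finite → Function.support w ⊆ Sites₀ t A → |∑' p : Sites₀ t A, ⟪g p, w p⟫| ≤ Ng * Real.sqrt (nnForm t A w)) →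
      ∀ p ∈ Sites₀ t A, 𝒢 (f + g) p = 𝒢 f p + 𝒢 g p)
    (hviii : ∀ (ι : Type) (F : ι → EuclideanSpace ℝ (Fin 3) → EuclideanSpace ℝ (Fin 3)) (Nn : ι → ℝ)
      (f : EuclideanSpace ℝ (Fin 3) → EuclideanSpace ℝ (Fin 3)), (∀ n, 0 ≤ Nn n) → Summable Nn →
      (∀ n, (∀ w : EuclideanSpace ℝ (Fin 3) → EuclideanSpace ℝ (Fin 3), (Function.support w).Finite → Function.support w ⊆ Sites₀ t A → |∑' p : Sites₀ t A, ⟪(F n) p, w p⟫| ≤ Nn n * Real.sqrt (nnForm t A w))) →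
      (∀ p ∈ Sites₀ t A, HasSum (fun n => F n p) (f p)) → ∀ p ∈ Sites₀ t A, HasSum (fun n => 𝒢 (F n) p) (𝒢 f p))
    (hcross : ∀ η : EuclideanSpace ℝ (Fin 3),
      Summable (fun x : Sites₀ t A => ‖𝒢 (fun y : EuclideanSpace ℝ (Fin 3) => if y = t 0 then η else 0) x - 𝒢 (fun y : EuclideanSpace ℝ (Fin 3) => if y = t 1 then η else 0) x‖ ^ 2) ∧
        ∑' x : Sites₀ t A, ‖𝒢 (fun y : EuclideanSpace ℝ (Fin 3) => if y = t 0 then η else 0) x - 𝒢 (fun y : EuclideanSpace ℝ (Fin 3) => if y = t 1 then η else 0) x‖ ^ 2 ≤ (Ccr * ‖η‖) ^ 2)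
    (M : EuclideanSpace ℝ (Fin 3) → EuclideanSpace ℝ (Fin 3) → EuclideanSpace ℝ (Fin 3))
    (hM : ∀ p q : EuclideanSpace ℝ (Fin 3), M q p = -M p q)
    (hW : Summable (fun pq : Sites₀ t A × Sites₀ t A =>
      ‖M pq.1 pq.2‖ * (1 + dist (pq.1 : EuclideanSpace ℝ (Fin 3)) pq.2))) :
    (∀ p : Sites₀ t A, HasSum (fun q : Sites₀ t A =>
        forceConst ((p : EuclideanSpace ℝ (Fin 3)) - q) (𝒢 (fun x => ∑' q : Sites₀ t A, M x q) p -
          𝒢 (fun x => ∑' q : Sites₀ t A, M x q) q)) (∑' q : Sites₀ t A, M p q)) ∧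
      Summable (fun p : Sites₀ t A => ‖𝒢 (fun x => ∑' q : Sites₀ t A, M x q) p‖ ^ 2) ∧
      ∑' p : Sites₀ t A, ‖𝒢 (fun x => ∑' q : Sites₀ t A, M x q) p‖ ^ 2 ≤
        (((((1100 / 189 : ℝ) * (C₂ / κ * Real.sqrt C₁)) + Ccr) / 2) *
          ∑' pq : Sites₀ t A × Sites₀ t A, ‖M pq.1 pq.2‖ * (1 + dist (pq.1 : EuclideanSpace ℝ (Fin 3)) pq.2)) ^ 2 := by
  set f : EuclideanSpace ℝ (Fin 3) → EuclideanSpace ℝ (Fin 3) := fun x => ∑' q : Sites₀ t A, M x q with hf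
  set Cp : ℝ := ((1100 / 189 : ℝ) * (C₂ / κ * Real.sqrt C₁)) + Ccr with hCp
  have hCp0 : 0 ≤ Cp := by positivity
  -- the dipole family
  set F : Sites₀ t A × Sites₀ t A → EuclideanSpace ℝ (Fin 3) → EuclideanSpace ℝ (Fin 3) := fun pq y =>
      (if y = pq.1 then (1 / 2 : ℝ) • M pq.1 pq.2 else 0) - (if y = pq.2 then (1 / 2 : ℝ) • M pq.1 pq.2 else 0) with hF
  set Nn : Sites₀ t A × Sites₀ t A → ℝ := fun pq =>
      C₀ * (1 + dist (pq.1 : EuclideanSpace ℝ (Fin 3)) pq.2) * ‖(1 / 2 : ℝ) • M pq.1 pq.2‖ with hNn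
  have hNn0 : ∀ pq, 0 ≤ Nn pq := fun pq => by positivity
  have hhalf : ∀ pq : Sites₀ t A × Sites₀ t A, ‖(1 / 2 : ℝ) • M pq.1 pq.2‖ = (1 / 2) * ‖M pq.1 pq.2‖ := fun pq => by
    rw [norm_smul, Real.norm_eq_abs, abs_of_pos (by norm_num : (0 : ℝ) < 1 / 2)]
  have hNns : Summable Nn := by
    refine (hW.mul_left (C₀ / 2)).congr fun pq => ?_
    simp only [hNn, hhalf]; ring
  have hNadm : ∀ pq : Sites₀ t A × Sites₀ t A, (∀ w : EuclideanSpace ℝ (Fin 3) → EuclideanSpace ℝ (Fin 3), (Function.support w).Finite → Function.support w ⊆ Sites₀ t A → |∑' p : Sites₀ t A, ⟪(F pq) p, w p⟫| ≤ Nn pq * Real.sqrt (nnForm t A w)) :=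
    fun pq => adm_dipole (t := t) (A := A) hpath pq.1.2 pq.2.2 ((1 / 2 : ℝ) • M pq.1 pq.2)
  have hFsum : ∀ p ∈ Sites₀ t A, HasSum (fun pq => F pq p) (f p) := fun p hp => hasSum_dipoles_div M hM hW hp
  -- admissibility of `f` and the rows of `z = 𝒢 f`
  have hfadm := adm_of_hasSum (t := t) (A := A) F Nn f hNn0 hNns hNadm hFsum
  have hrows := hi f (∑' pq, Nn pq) (tsum_nonneg hNn0) hfadm
  refine ⟨hrows, ?_⟩
  -- the responses and their bounds
  have hresp := hviii (Sites₀ t A × Sites₀ t A) F Nn f hNn0 hNns hNadm hFsum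
  set β : Sites₀ t A × Sites₀ t A → ℝ := fun pq =>
      Cp * (1 + dist (pq.1 : EuclideanSpace ℝ (Fin 3)) pq.2) * ‖(1 / 2 : ℝ) • M pq.1 pq.2‖ with hβ
  have hβ0 : ∀ pq, 0 ≤ β pq := fun pq => by positivity
  have hβs : Summable β := by
    refine (hW.mul_left (Cp / 2)).congr fun pq => ?_
    simp only [hβ, hhalf]; ring
  have hβt : ∑' pq, β pq = Cp / 2 * ∑' pq : Sites₀ t A × Sites₀ t A,
      ‖M pq.1 pq.2‖ * (1 + dist (pq.1 : EuclideanSpace ℝ (Fin 3)) pq.2) := by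
    rw [← tsum_mul_left]
    exact tsum_congr fun pq => by simp only [hβ, hhalf]; ring
  have hGF : ∀ (pq : Sites₀ t A × Sites₀ t A) (x : Sites₀ t A), 𝒢 (F pq) x =
      𝒢 (fun y : EuclideanSpace ℝ (Fin 3) => if y = pq.1 then (1 / 2 : ℝ) • M pq.1 pq.2 else 0) x -
        𝒢 (fun y : EuclideanSpace ℝ (Fin 3) => if y = pq.2 then (1 / 2 : ℝ) • M pq.1 pq.2 else 0) x :=
    fun pq x => green_dipole_eq (𝒢 := 𝒢) hcap hv hvii pq.1.2 pq.2.2 _ x.2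
  have hbound : ∀ pq : Sites₀ t A × Sites₀ t A, Summable (fun x : Sites₀ t A => ‖𝒢 (F pq) x‖ ^ 2) ∧
      ∑' x : Sites₀ t A, ‖𝒢 (F pq) x‖ ^ 2 ≤ β pq ^ 2 := by
    intro pq
    simp only [hGF]
    exact pair_sq_le (𝒢 := 𝒢) hA hI hκ hC₂ hCcr hcap hiv hvi hcross pq.1.2 pq.2.2 ((1 / 2 : ℝ) • M pq.1 pq.2)
  have hmain := tsum_norm_sq_le_of_hasSum (fun pq (x : Sites₀ t A) => 𝒢 (F pq) x) (fun x : Sites₀ t A => 𝒢 f x) β hβ0 hβs hbound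
    (fun x => hresp x x.2)
  refine ⟨hmain.1, hmain.2.trans (le_of_eq ?_)⟩
  rw [hβt]


/-- Registered sub-goal carrying this file (crux stmt-AtomisticToContinuum-9332, line `Sketch` v4, part H3e of
`stub_green`): the divergence of an antisymmetric bond field is the pointwise sum of its dipoles. [folklore] -/
theorem _root_.Summit.AtomisticToContinuum.Crystallization.Theorems.ExcessDecayLiouville.blowdown_hasSumDipolesDiv :
    ∀ (t : Fin 2 → EuclideanSpace ℝ (Fin 3)) (A : EuclideanSpace ℝ (Fin 3) →L[ℝ] EuclideanSpace ℝ (Fin 3)) (M : EuclideanSpace ℝ (Fin 3) → EuclideanSpace ℝ (Fin 3) → EuclideanSpace ℝ (Fin 3)), (∀ p q : EuclideanSpace ℝ (Fin 3), M q p = -M p q) → Summable (fun pq : Sites₀ t A × Sites₀ t A => ‖M pq.1 pq.2‖ * (1 + dist (pq.1 : EuclideanSpace ℝ (Fin 3)) pq.2)) → ∀ x : EuclideanSpace ℝ (Fin 3), x ∈ Sites₀ t A → HasSum (fun pq : Sites₀ t A × Sites₀ t A => (fun y : EuclideanSpace ℝ (Fin 3) => (if y = pq.1 then (1 / 2 :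 ℝ) • M pq.1 pq.2 else 0) - (if y = pq.2 then (1 / 2 : ℝ) • M pq.1 pq.2 else 0)) x) (∑' q : Sites₀ t A, M x q) :=
  fun _ _ M hM hW _ hx => hasSum_dipoles_div M hM hW hx

end

end Blowdown

end Summit.AtomisticToContinuum.Crystallization.Theorems.ExcessDecayLiouville

end
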